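import Summits.KontsevichZagierPeriods.KontsevichZagierPeriods.Theses.LinRedNormalForm
import Summits.KontsevichZagierPeriods.KontsevichZagierPeriods.Theorems.HoffmanIndependence.Negative.DiagonalAndStrength
import Literature.NumberTheory.Transcendental.MultipleZetaValuesHoffmanProofs
import Literature.NumberTheory.Transcendental.MultipleZetaValuesBridgeProofs
import Literature.NumberTheory.Transcendental.AperyIrrationality
import Literature.NumberTheory.Transcendental.LindemannWeierstrassProofs
import Mathlib.LinearAlgebra.DFinsupp
import Mathlib.LinearAlgebra.LinearIndependent.Lemmas
import Mathlib.LinearAlgebra.Span.Basic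
import Mathlib.Order.CompactlyGenerated.Basic
import Mathlib.Tactic.IntervalCases

/-!
# Crux `HoffmanIndependence` (stmt-KontsevichZagierPeriods-15045), line `weight_split` —
# the rung ladders of the two stubs, and their first open rungs typed

Line `weight_split` splits the crux EXACTLY into
`stub_weightGrading : iSupIndep hoffmanSpan` (grading of the real Hoffman weight spans; Goncharov's
grading conjecture on the Hoffman spans) and
`stub_inWeight : ∀ n, LinearIndependent ℚ (ζ on the weight-n Hoffman indices)` (Zagier's dimension
lower bound in Brown's basis) — glue `HoffmanIndependence_of_subs`
(`Theorems/LinRedNormalFormHoffmanIndependenceSplit.lean`). Both stubs are declared open inputs.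
This file records, sorry-free, exactly how far the tree's transcendence input reaches INTO each
stub, and types the first open rung of each as an elementary statement about three (resp. two)
real numbers:

* `weightGrading_iff_forall_initial` — STUB 1 IS ITS RUNG LADDER: `iSupIndep hoffmanSpan` iff
  every initial segment `{hoffmanSpan n}_{n ≤ N}` is independent (compactness of the submodule
  lattice: a dependence involves finitely many weights).
* rungs of stub 1 that are THEOREMS: `weightGrading_initial_two` (weights `≤ 2`: `1, ζ(2)`),
  `weightGrading_initial_four_ne_three` (weights `0,1,2,4`: `1, π², π⁴`, Lindemann),
  `weightGrading_initial_three_ne_two` (weights `0,1,3`: `1, ζ(3)`, Apéry).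
* the FIRST OPEN rung of stub 1, typed: `weightGrading_initial_three_iff` — weights `≤ 3` are
  independent iff `1, ζ(2), ζ(3)` are `ℚ`-linearly independent iff `ζ(3) ∉ ℚ + ℚπ²`
  (`weightGrading_initial_three_iff_zeta_three`); this is `Cruxes/…/Disproof.lean` §E
  `nearMiss_weight_le_three`, now an honest equivalence instead of a sorried target.
* the FIRST OPEN rung of stub 2, typed: `inWeight_five_iff` — the weight-5 slice
  `{ζ(3,2), ζ(2,3)}` is independent iff `ζ(5) ∉ ℚ·ζ(2)ζ(3)` (weight-5 double shuffle:
  `ζ(2,3) = (9/2)ζ(5) − 2ζ(2)ζ(3)`, `ζ(3,2) = 3ζ(2)ζ(3) − (11/2)ζ(5)`); this is Disproof §E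
  `nearMiss_weight_five` as an equivalence (rungs `n ≤ 4` of stub 2 are `inWeight_of_le_four`).

No new definitions; nothing here closes the item. [cite: Zagier1994, §9]
[cite: GoncharovECM2001, Conjecture 1.1] [cite: Apery1979] [cite: Lindemann1882]
-/

noncomputable section

namespace Summit.KontsevichZagierPeriods.LinRedNormalForm.HoffmanIndependence

open Literature.NumberTheory.Transcendental MZV
open Summit.KontsevichZagierPeriods.HoffmanIndependence.Negative (linearIndependent_pow_of_transcendental)

/-! ## Stub 1 is its rung ladder -/

/-- **Stub 1 ⟺ all its initial segments.** `iSupIndep hoffmanSpan` holds iff for every `N` the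
finite family `(hoffmanSpan n)_{n ≤ N}` is independent: a non-trivial intersection
`hoffmanSpan i ⊓ ⨆_{j ≠ i} hoffmanSpan j` is witnessed inside finitely many weights
(`iSupIndep_iff_supIndep`, compactly generated submodule lattice). So `stub_weightGrading` is
EXACTLY the conjunction of its rungs `N = 0, 1, 2, …`; rungs `N ≤ 2` are theorems
(`weightGrading_initial_two`), rung `N = 3` is `ζ(3) ∉ ℚ + ℚπ²` (`weightGrading_initial_three_iff`).
[folklore] -/
theorem weightGrading_iff_forall_initial :
    iSupIndep hoffmanSpan ↔ ∀ N : ℕ, iSupIndep (fun n : {n : ℕ // n ≤ N} => hoffmanSpan n.1) := by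
  refine ⟨fun h N => h.comp Subtype.val_injective, fun h => ?_⟩
  rw [iSupIndep_iff_supIndep]
  intro s
  classical
  have hmem : ∀ n ∈ s, n ≤ s.sup id := fun n hn => by
    simpa using Finset.le_sup (f := id) hn
  have h1 : (s.subtype fun n => n ≤ s.sup id).SupIndep
      ((hoffmanSpan) ∘ (Function.Embedding.subtype fun n => n ≤ s.sup id)) :=
    (h (s.sup id)).supIndep' _
  rw [← Finset.supIndep_map, Finset.subtype_map_of_mem hmem] at h1
  exact h1

/-- Every restriction of stub 1 to a set of weights is a consequence of stub 1 (so each rung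
below is literally an instance of `stub_weightGrading`). [folklore] -/
theorem weightGrading_restrict (h : iSupIndep hoffmanSpan) (p : ℕ → Prop) :
    iSupIndep (fun n : {n : ℕ // p n} => hoffmanSpan n.1) :=
  h.comp Subtype.val_injective

/-- Transfer lemma: a family of subspaces each contained in the line of a member of a
`ℚ`-linearly independent family, along an index map injective where the subspaces are non-zero,
is independent. [folklore] -/
theorem iSupIndep_of_le_span_singleton {ι κ : Type*} {v : κ → ℝ} (hv : LinearIndependent ℚ v)
    {t : ι → Submodule ℚ ℝ} (f : ι → κ) (hf : Set.InjOn f {i | t i ≠ ⊥})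
    (hle : ∀ i, t i ≤ ℚ ∙ v (f i)) : iSupIndep t := by
  rw [← iSupIndep_ne_bot]
  have hinj : Function.Injective (fun i : {i // t i ≠ ⊥} => f i.1) :=
    fun a b hab => Subtype.ext (hf a.2 b.2 hab)
  exact (hv.iSupIndep_span_singleton.comp hinj).mono fun i => hle i.1

/-! ## The Hoffman spans of weight `≤ 4` (lines or zero) -/

/-- `hoffmanSpan 0 = ℚ · 1` (`ζ(∅) = 1`). [folklore] -/
theorem hoffmanSpan_zero_eq_span_one : hoffmanSpan 0 = ℚ ∙ (1 : ℝ) :=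
  hoffmanSpan_zero_eq.trans mzvSpace_zero_eq

/-- `hoffmanSpan 1 = 0` (no index of weight `1`). [folklore] -/
theorem hoffmanSpan_one_eq_bot : hoffmanSpan 1 = ⊥ :=
  hoffmanSpan_one_eq.trans mzvSpace_one_eq_bot

/-- `hoffmanSpan 2 = ℚ · ζ(2)`. [folklore] -/
theorem hoffmanSpan_two_eq_span : hoffmanSpan 2 = ℚ ∙ multipleZeta [2] :=
  hoffmanSpan_two_eq.trans mzvSpace_two_eq

/-- `hoffmanSpan 3 = ℚ · ζ(3)`. [folklore] -/
theorem hoffmanSpan_three_eq_span : hoffmanSpan 3 = ℚ ∙ multipleZeta [3] :=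
  hoffmanSpan_three_eq.trans mzvSpace_three_eq'

/-- `ζ(2) ∈ ℚ · π²` (`ζ(2) = π²/6`). [folklore] -/
theorem multipleZeta_two_mem_span_pi_sq : multipleZeta [2] ∈ ℚ ∙ (Real.pi ^ 2) := by
  rw [Submodule.mem_span_singleton]
  refine ⟨(6 : ℚ)⁻¹, ?_⟩
  rw [multipleZeta_two, Rat.smul_def]
  push_cast
  ring

/-! ## Rungs of stub 1 that are theorems -/

/-- **Rung {0,1,2,4} of stub 1** (Lindemann): the Hoffman spans of weights `0, 1, 2, 4` —
`ℚ`, `0`, `ℚπ²`, `ℚπ⁴` — are independent, since the powers of the transcendental number `π` are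
`ℚ`-linearly independent (`transcendental_pi_holds`). Weight `3` is excluded: with it the
statement is the open rung `weightGrading_initial_three_iff`. [cite: Lindemann1882] -/
theorem weightGrading_initial_four_ne_three :
    iSupIndep (fun n : {n : ℕ // n ≤ 4 ∧ n ≠ 3} => hoffmanSpan n.1) := by
  have hpow : LinearIndependent ℚ (fun m : ℕ => Real.pi ^ m) :=
    linearIndependent_pow_of_transcendental transcendental_pi_holds
  refine iSupIndep_of_le_span_singleton hpow (fun n => n.1) Subtype.val_injective.injOn ?_
  rintro ⟨n, hn4, hn3⟩
  interval_cases n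
  · rw [hoffmanSpan_zero_eq_span_one, pow_zero]
  · rw [hoffmanSpan_one_eq_bot]
    exact bot_le
  · rw [hoffmanSpan_two_eq_span]
    exact (Submodule.span_singleton_le_iff_mem _ _).2 multipleZeta_two_mem_span_pi_sq
  · exact absurd rfl hn3
  · rw [hoffmanSpan_four_eq_span_pi_pow_four]

/-- **Rung N = 2 of stub 1**: the Hoffman spans of weights `≤ 2` (`ℚ`, `0`, `ℚζ(2)`) are
independent (`π²` is irrational). [cite: Lindemann1882] -/
theorem weightGrading_initial_two :
    iSupIndep (fun n : {n : ℕ // n ≤ 2} => hoffmanSpan n.1) :=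
  weightGrading_initial_four_ne_three.comp
    (f := fun n : {n : ℕ // n ≤ 2} => (⟨n.1, by have := n.2; omega, by have := n.2; omega⟩ :
      {n : ℕ // n ≤ 4 ∧ n ≠ 3}))
    fun a b hab => Subtype.ext (by simpa using congrArg Subtype.val hab)

/-- `1, ζ(3)` are `ℚ`-linearly independent — Apéry's theorem `ζ(3) ∉ ℚ`
(`Apery.irrational_zeta_three`, proved in the tree). [cite: Apery1979] -/
theorem linearIndependent_one_zeta_three :
    LinearIndependent ℚ ![(1 : ℝ), multipleZeta [3]] := by
  have hirr : Irrational (multipleZeta [3]) := by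
    rw [multipleZeta_singleton_eq_zetaValue_of_ne_zero (by norm_num)]
    exact Apery.irrational_zeta_three
  rw [LinearIndependent.pair_symm_iff, linearIndependent_fin2]
  refine ⟨by simp, fun a ha => ?_⟩
  -- `a • 1 = ζ(3)` would make `ζ(3)` rational
  refine hirr ⟨a, ?_⟩
  have : (a : ℝ) = multipleZeta [3] := by simpa [Rat.smul_def] using ha
  exact this

/-- **Rung {0,1,3} of stub 1** (Apéry): the Hoffman spans of weights `0, 1, 3` — `ℚ`, `0`,
`ℚζ(3)` — are independent. Weight `2` is excluded: with it the statement is the open rung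
`weightGrading_initial_three_iff`. [cite: Apery1979] -/
theorem weightGrading_initial_three_ne_two :
    iSupIndep (fun n : {n : ℕ // n ≤ 3 ∧ n ≠ 2} => hoffmanSpan n.1) := by
  refine iSupIndep_of_le_span_singleton linearIndependent_one_zeta_three
    (fun n => if n.1 = 0 then (0 : Fin 2) else 1) ?_ ?_
  · rintro ⟨a, ha3, ha2⟩ ha ⟨b, hb3, hb2⟩ hb hab
    simp only [ne_eq, Set.mem_setOf_eq] at ha hb
    have ha1 : a ≠ 1 := by rintro rfl; exact ha hoffmanSpan_one_eq_bot
    have hb1 : b ≠ 1 := by rintro rfl; exact hb hoffmanSpan_one_eq_bot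
    apply Subtype.ext
    by_cases ha0 : a = 0 <;> by_cases hb0 : b = 0 <;> simp [ha0, hb0] at hab ⊢
    all_goals omega
  · rintro ⟨n, hn3, hn2⟩
    interval_cases n
    · simp only [if_true, Matrix.cons_val_zero, hoffmanSpan_zero_eq_span_one, le_refl]
    · rw [hoffmanSpan_one_eq_bot]
      exact bot_le
    · exact absurd rfl hn2
    · simp only [show (3 : ℕ) ≠ 0 from by decide, if_false, Matrix.cons_val_one,
        Matrix.cons_val_fin_one, hoffmanSpan_three_eq_span, le_refl]

/-! ## The first open rung of stub 1, typed -/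

/-- The three Hoffman weights `0, 2, 3` inside `{n ≤ 3}`. [folklore] -/
theorem initialThree_injective :
    Function.Injective (![⟨0, by norm_num⟩, ⟨2, by norm_num⟩, ⟨3, by norm_num⟩] :
      Fin 3 → {n : ℕ // n ≤ 3}) := by
  intro i j hij
  fin_cases i <;> fin_cases j <;> simp_all

/-- **FIRST OPEN RUNG OF STUB 1, typed**: the Hoffman spans of weights `≤ 3` (`ℚ`, `0`, `ℚζ(2)`,
`ℚζ(3)`) are independent iff the three real numbers `1, ζ(2), ζ(3)` are `ℚ`-linearly
independent. This is `Disproof.lean` §E `nearMiss_weight_le_three` as an equivalence; it is OPEN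
(Apéry gives `ζ(3) ∉ ℚ`, Lindemann `π² ∉ ℚ`; no method separates `ζ(3)` from `ℚ + ℚπ²`).
[cite: Zagier1994, §9] -/
theorem weightGrading_initial_three_iff :
    iSupIndep (fun n : {n : ℕ // n ≤ 3} => hoffmanSpan n.1) ↔
      LinearIndependent ℚ ![(1 : ℝ), multipleZeta [2], multipleZeta [3]] := by
  have hne : ∀ i : Fin 3, ![(1 : ℝ), multipleZeta [2], multipleZeta [3]] i ≠ 0 := by
    intro i
    fin_cases i
    · simp
    · simpa using multipleZeta_two_ne_zero
    · simpa using multipleZeta_three_ne_zero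
  constructor
  · intro h
    rw [← iSupIndep_iff_linearIndependent_of_ne_zero hne]
    have h3 := h.comp initialThree_injective
    convert h3 using 1
    funext i
    fin_cases i
    · simp [hoffmanSpan_zero_eq_span_one]
    · simp [hoffmanSpan_two_eq_span]
    · simp [hoffmanSpan_three_eq_span]
  · intro hv
    refine iSupIndep_of_le_span_singleton hv
      (fun n => if n.1 = 0 then (0 : Fin 3) else if n.1 = 2 then 1 else 2) ?_ ?_
    · rintro ⟨a, ha3⟩ ha ⟨b, hb3⟩ hb hab
      simp only [ne_eq, Set.mem_setOf_eq] at ha hb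
      have ha1 : a ≠ 1 := by rintro rfl; exact ha hoffmanSpan_one_eq_bot
      have hb1 : b ≠ 1 := by rintro rfl; exact hb hoffmanSpan_one_eq_bot
      apply Subtype.ext
      show a = b
      interval_cases a <;> interval_cases b <;> first | rfl | (exfalso; simp at hab ha1 hb1)
    · rintro ⟨n, hn3⟩
      interval_cases n
      · simp [hoffmanSpan_zero_eq_span_one]
      · rw [hoffmanSpan_one_eq_bot]
        exact bot_le
      · simp [hoffmanSpan_two_eq_span]
      · simp [hoffmanSpan_three_eq_span]

/-- `1, ζ(2)` are `ℚ`-linearly independent (`ζ(2) = π²/6`, `π` transcendental). [cite: Lindemann1882] -/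
theorem linearIndependent_one_zeta_two :
    LinearIndependent ℚ ![(1 : ℝ), multipleZeta [2]] := by
  have hpow : LinearIndependent ℚ (fun m : ℕ => Real.pi ^ m) :=
    linearIndependent_pow_of_transcendental transcendental_pi_holds
  have h02 : LinearIndependent ℚ ![(1 : ℝ), Real.pi ^ 2] := by
    have h := hpow.comp (![0, 2] : Fin 2 → ℕ) (by intro i j hij; fin_cases i <;> fin_cases j <;> simp_all)
    convert h using 1
    funext i
    fin_cases i <;> simp
  have hu := h02.units_smul ![1, Units.mk0 ((6 : ℚ)⁻¹) (by norm_num)]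
  convert hu using 1
  funext i
  fin_cases i
  · simp
  · simp only [Fin.mk_one, Matrix.cons_val_one, Matrix.cons_val_fin_one, Pi.smul_apply',
      Units.smul_def, Units.val_mk0, multipleZeta_two, Rat.smul_def]
    push_cast
    ring

/-- **FIRST OPEN RUNG OF STUB 1 = `ζ(3) ∉ ℚ + ℚπ²`.** Since `1, ζ(2)` are already independent
(`linearIndependent_one_zeta_two`) and `ζ(2) = π²/6`, the rung `N = 3` of `stub_weightGrading` is
exactly the statement that `ζ(3)` is not of the form `a + bπ²` with `a, b ∈ ℚ`. [cite: Zagier1994, §9] -/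
theorem weightGrading_initial_three_iff_zeta_three :
    iSupIndep (fun n : {n : ℕ // n ≤ 3} => hoffmanSpan n.1) ↔
      ∀ a b : ℚ, multipleZeta [3] ≠ a + b * Real.pi ^ 2 := by
  rw [weightGrading_initial_three_iff, linearIndependent_finSucc']
  have hinit : Fin.init ![(1 : ℝ), multipleZeta [2], multipleZeta [3]] = ![(1 : ℝ), multipleZeta [2]] := by
    funext i
    fin_cases i <;> rfl
  rw [hinit]
  simp only [linearIndependent_one_zeta_two, true_and]
  have hlast : ![(1 : ℝ), multipleZeta [2], multipleZeta [3]] (Fin.last 2) = multipleZeta [3] := rfl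
  rw [hlast, Submodule.mem_span_range_iff_exists_fun, not_exists]
  constructor
  · intro h a b hab
    refine h ![a, 6 * b] ?_
    rw [Fin.sum_univ_two]
    simp only [Matrix.cons_val_zero, Matrix.cons_val_one, Matrix.cons_val_fin_one, Rat.smul_def,
      multipleZeta_two, hab]
    push_cast
    ring
  · intro h c hc
    refine h (c 0) (c 1 / 6) ?_
    rw [Fin.sum_univ_two] at hc
    simp only [Matrix.cons_val_zero, Matrix.cons_val_one, Matrix.cons_val_fin_one, Rat.smul_def,
      multipleZeta_two] at hc
    rw [← hc]
    push_cast
    ring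

/-! ## The first open rung of stub 2, typed -/

/-- The weight-5 Hoffman indices are `(3,2)` and `(2,3)`: an explicit bijection with `Fin 2`.
[folklore] -/
theorem hoffmanFive_bijective :
    Function.Bijective (![⟨[3, 2], by decide, rfl⟩, ⟨[2, 3], by decide, rfl⟩] :
      Fin 2 → {u : List ℕ // IsHoffman u ∧ weight u = 5}) := by
  refine ⟨fun i j hij => ?_, fun u => ?_⟩
  · fin_cases i <;> fin_cases j <;> simp_all
  · rcases u with ⟨u, hu, hw⟩
    rcases MZV.eq_of_isHoffman_of_weight_eq_five hu hw with rfl | rfl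
    · exact ⟨0, rfl⟩
    · exact ⟨1, rfl⟩

/-- **FIRST OPEN RUNG OF STUB 2, typed**: the weight-5 slice of `stub_inWeight` — `ζ(3,2), ζ(2,3)`
`ℚ`-linearly independent — holds iff `ζ(5) ∉ ℚ · ζ(2)ζ(3)`. By the weight-5 double shuffle
evaluations `ζ(2,3) = (9/2)ζ(5) − 2ζ(2)ζ(3)`, `ζ(3,2) = 3ζ(2)ζ(3) − (11/2)ζ(5)` (tree theorems) the
pair `(ζ(3,2), ζ(2,3))` is an invertible `ℚ`-linear image of `(ζ(2)ζ(3), ζ(5))` (determinant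
`5/2`), and `ζ(2)ζ(3) ≠ 0`. This is `Disproof.lean` §E `nearMiss_weight_five` as an equivalence;
not even `ζ(5) ∉ ℚ` is known. Rungs `n ≤ 4` are theorems (`inWeight_of_le_four`).
[cite: Zagier1994, §9] -/
theorem inWeight_five_iff :
    LinearIndependent ℚ
        (fun u : {u : List ℕ // IsHoffman u ∧ weight u = 5} => multipleZeta u.1) ↔
      ∀ q : ℚ, multipleZeta [5] ≠ q * (multipleZeta [2] * multipleZeta [3]) := by
  rw [← linearIndependent_equiv (Equiv.ofBijective _ hoffmanFive_bijective)]
  have hfam : (fun u : {u : List ℕ // IsHoffman u ∧ weight u = 5} => multipleZeta u.1) ∘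
      (Equiv.ofBijective _ hoffmanFive_bijective) = ![multipleZeta [3, 2], multipleZeta [2, 3]] := by
    funext i
    fin_cases i <;> rfl
  rw [hfam, LinearIndependent.pair_iff]
  set P := multipleZeta [2] * multipleZeta [3] with hP
  have hP0 : P ≠ 0 := mul_ne_zero multipleZeta_two_ne_zero multipleZeta_three_ne_zero
  have h32 : multipleZeta [3, 2] = 3 * P - 11 / 2 * multipleZeta [5] := multipleZeta_three_two_eq
  have h23 : multipleZeta [2, 3] = 9 / 2 * multipleZeta [5] - 2 * P := multipleZeta_two_three_eq
  constructor
  · -- a relation `ζ(5) = q ζ(2)ζ(3)` makes `ζ(3,2)`, `ζ(2,3)` proportional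
    intro h q hq
    have key := h (9 / 2 * q - 2) (-(3 - 11 / 2 * q)) (by
      rw [Rat.smul_def, Rat.smul_def, h32, h23, hq]
      push_cast
      ring)
    rcases key with ⟨h1, h2⟩
    have : (9 / 2 : ℚ) * q - 2 = 0 ∧ (3 : ℚ) - 11 / 2 * q = 0 := ⟨h1, by linarith⟩
    rcases this with ⟨e1, e2⟩
    have hq1 : q = 4 / 9 := by linarith
    have hq2 : q = 6 / 11 := by linarith
    norm_num [hq1] at hq2
  · -- no such relation: a vanishing combination has both coefficients zero
    intro h s t hst
    rw [Rat.smul_def, Rat.smul_def, h32, h23] at hst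
    -- `hst : s (3P - 11/2 ζ(5)) + t (9/2 ζ(5) - 2P) = 0`, i.e.
    -- `ζ(5) (9t - 11s) = 2 (2t - 3s) P`
    by_cases hc : 9 * t - 11 * s = 0
    · -- the `ζ(5)`-coefficient vanishes: then `(5/9) s P = 0`, so `s = 0`, so `t = 0`
      have ht : (t : ℝ) = 11 / 9 * s := by
        have hc' : ((9 * t - 11 * s : ℚ) : ℝ) = 0 := by rw [hc, Rat.cast_zero]
        push_cast at hc'
        linarith
      rw [ht] at hst
      have hsP : (s : ℝ) * P = 0 := by linear_combination (9 / 5 : ℝ) * hst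
      have hs : (s : ℝ) = 0 := by
        rcases mul_eq_zero.1 hsP with h0 | h0
        · exact h0
        · exact absurd h0 hP0
      have hs' : s = 0 := by exact_mod_cast hs
      have ht' : t = 0 := by
        have : (t : ℝ) = 0 := by rw [ht, hs, mul_zero]
        exact_mod_cast this
      exact ⟨hs', ht'⟩
    · -- otherwise `ζ(5)` is a rational multiple of `P = ζ(2)ζ(3)`
      exfalso
      have hc' : (9 * t - 11 * s : ℝ) ≠ 0 := by
        have h0 : ((9 * t - 11 * s : ℚ) : ℝ) ≠ 0 := by
          rw [Ne, Rat.cast_eq_zero]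
          exact hc
        push_cast at h0
        exact h0
      have key : multipleZeta [5] * (9 * t - 11 * s : ℝ) = 2 * (2 * t - 3 * s) * P := by
        linear_combination 2 * hst
      refine h (2 * (2 * t - 3 * s) / (9 * t - 11 * s)) ?_
      push_cast
      rw [div_mul_eq_mul_div, eq_div_iff hc']
      exact key

end Summit.KontsevichZagierPeriods.LinRedNormalForm.HoffmanIndependence
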